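import Summits.ValiantsHypothesis.ValiantsHypothesis.Theorems.KPlusLogSqLawTropicalBSurplus

/-!
# Route `KPlusLogSqLaw`, crux `TropicalB` — the two regime stubs ON THE BANDED / HALL-SURPLUS SECTORS

HONEST FRAMING.  Helper toward the registered stubs of `Cruxes/TropicalB/Lines/birth.lean`
(crux `Summit.ValiantsHypothesis.ValiantsHypothesis.Theses.KPlusLogSqLaw.TropicalB`, ledger item
`stmt-ValiantsHypothesis-19771`, route `KPlusLogSqLaw`; cell `pub-symmetroid`, seat `val-sym-trop-p3`, 2026-08-26):

* `stub_tropFat  : ∃ C, ∀ m K, log₂² m ≤ K → TropRow m K (2 ^ (C·K))`,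
* `stub_tropThin : ∃ C, ∀ m K, K ≤ log₂² m → TropRow m K (2 ^ (C·log₂² m))`.

This file only REPACKAGES the sector theorems of `…TropicalBBanded` / `…TropicalBSurplus` (this seat, on
val-sym-trop-p1's `designRowD_split`) in the two stubs' exact shapes, so that the custody seat and the tribunal can read
off which part of each stub is a theorem:

* `fatStub_on_surplusSector` — the FAT stub's conclusion `n ≤ 2^(14·K)` (one absolute constant) for every design in the
  fat regime `log₂² m ≤ K` admitting a column order whose initial segments `[0,c)` meet at most `c + w` rows with
  `w·log₂² m ≤ K` (in particular every design of lower bandwidth `w ≤ K / log₂² m`: `fatStub_on_bandedSector`);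
* `thinStub_on_bandedSector w` — the THIN stub's conclusion `n ≤ 2^(C·log₂² m)` with `C = 2(6w+7)` for every design of
  lower bandwidth `w` in the thin regime `K ≤ log₂² m` (`w = 1`: Hessenberg = DAG-path designs, val-sym-trop-p5's class);
  `thinStub_on_surplusSector w` likewise.

HONEST RANGE: sectors of an OPEN conjecture; both stubs for general supports are untouched; nothing here bears on
`KPlusLogSqLaw`, `MatrixDescartes` or `VP ≠ VNP`. [folklore]
-/

set_option linter.dupNamespace false
set_option autoImplicit false

namespace Summit.ValiantsHypothesis.ValiantsHypothesis.Theorems.KPlusLogSqLaw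

open Summit.ValiantsHypothesis.ValiantsHypothesis.Theorems.MatrixDescartes.Negative
open Summit.ValiantsHypothesis.ValiantsHypothesis.Theorems.LacunarySymmetroidMatrixDescartes
open Summit.ValiantsHypothesis.ValiantsHypothesis.Theorems.LacunarySymmetroidMatrixDescartes.TropicalCensus
open scoped BigOperators
open Finset

/-- arithmetic: in the fat regime `L² ≤ K`, `2^(7(K+L²)) ≤ 2^(14 K)`. [folklore] -/
theorem two_pow_seven_le_fat {K L : ℕ} (h : L ^ 2 ≤ K) : 2 ^ (7 * (K + L ^ 2)) ≤ 2 ^ (14 * K) :=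
  Nat.pow_le_pow_right (by norm_num) (by omega)

/-- arithmetic: in the thin regime `K ≤ L²`, `2^(C'(K+L²)) ≤ 2^((2C') L²)`. [folklore] -/
theorem two_pow_le_thin {K L C' : ℕ} (h : K ≤ L ^ 2) : 2 ^ (C' * (K + L ^ 2)) ≤ 2 ^ (2 * C' * L ^ 2) :=
  Nat.pow_le_pow_right (by norm_num) (by nlinarith)

/-- **The fat stub on the Hall-surplus sector (one absolute constant, `C = 14`).**  In the fat regime `log₂² m ≤ K`,
every design of format `(m, K)` admitting a relabeling of rows and columns whose initial column segments `[0,c)` meet at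
most `c + w` rows, with `w · log₂² m ≤ K`, has sign-alternating dominant chains of length `≤ 2^(14·K)` — the conclusion
of `stub_tropFat` on this sector. [folklore] -/
theorem fatStub_on_surplusSector {m K : ℕ} (w : ℕ) (d : Fin K → ℕ) (v ε : Fin m → Fin m → Fin K → ℤ)
    (π ρ : Equiv.Perm (Fin m))
    (hε : ∀ c : ℕ, ((univ : Finset (Fin m)).filter
        (fun a : Fin m => ∃ b : Fin m, (b : ℕ) < c ∧ ∃ l : Fin K, ε (π a) (ρ b) l ≠ 0)).card ≤ c + w)
    (hfat : Nat.log 2 m ^ 2 ≤ K) (hw : w * Nat.log 2 m ^ 2 ≤ K)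
    {n : ℕ} (θ : Fin (n + 1) → ℤ) (p : Fin (n + 1) → Equiv.Perm (Fin m) × (Fin m → Fin K))
    (hθ : StrictMono θ) (hdom : ∀ k, IsDominant d v ε (θ k) (p k))
    (halt : ∀ k : Fin n, termSign ε (p k.castSucc) * termSign ε (p k.succ) < 0) :
    n ≤ 2 ^ (14 * K) :=
  (surplus_kPlusLogSq_of_relabel w d v ε π ρ hε hw θ p hθ hdom halt).trans (two_pow_seven_le_fat hfat)

/-- **The fat stub on the banded sector.**  In the fat regime `log₂² m ≤ K`, every design of lower bandwidth `w` with
`w · log₂² m ≤ K` has sign-alternating dominant chains of length `≤ 2^(14·K)`. [folklore] -/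
theorem fatStub_on_bandedSector {m K : ℕ} (w : ℕ) (d : Fin K → ℕ) (v ε : Fin m → Fin m → Fin K → ℤ)
    (hε : ∀ a b l, ε a b l ≠ 0 → (a : ℕ) ≤ (b : ℕ) + w)
    (hfat : Nat.log 2 m ^ 2 ≤ K) (hw : w * Nat.log 2 m ^ 2 ≤ K)
    {n : ℕ} (θ : Fin (n + 1) → ℤ) (p : Fin (n + 1) → Equiv.Perm (Fin m) × (Fin m → Fin K))
    (hθ : StrictMono θ) (hdom : ∀ k, IsDominant d v ε (θ k) (p k))
    (halt : ∀ k : Fin n, termSign ε (p k.castSucc) * termSign ε (p k.succ) < 0) :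
    n ≤ 2 ^ (14 * K) :=
  (band_kPlusLogSq w d v ε hε hw θ p hθ hdom halt).trans (two_pow_seven_le_fat hfat)

/-- **The fat stub in its registered shape, on the banded sector**: ONE constant `C` (`= 14`) such that for all `m, K`
with `log₂² m ≤ K` and every design of format `(m, K)` of lower bandwidth at most `K / log₂² m` (hypothesis
`w · log₂² m ≤ K`), `n ≤ 2^(C·K)`. [folklore] -/
theorem fatStub_bandedSector : ∃ C : ℕ, ∀ (m K w : ℕ), Nat.log 2 m ^ 2 ≤ K → w * Nat.log 2 m ^ 2 ≤ K →
    ∀ (d : Fin K → ℕ) (v ε : Fin m → Fin m → Fin K → ℤ), (∀ a b l, ε a b l ≠ 0 → (a : ℕ) ≤ (b : ℕ) + w) →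
    ∀ (n : ℕ) (θ : Fin (n + 1) → ℤ) (p : Fin (n + 1) → Equiv.Perm (Fin m) × (Fin m → Fin K)),
      (∀ i j l, (ε i j l).natAbs ≤ 1) → StrictMono θ → (∀ k, IsDominant d v ε (θ k) (p k)) →
      (∀ k : Fin n, termSign ε (p k.castSucc) * termSign ε (p k.succ) < 0) → n ≤ 2 ^ (C * K) :=
  ⟨14, fun _ _ w hfat hw d v ε hε _ θ p _ hθ hdom halt => fatStub_on_bandedSector w d v ε hε hfat hw θ p hθ hdom halt⟩

/-- **The thin stub on the banded sector, per width**: for every `w` there is `C` (`= 2(6w+7)`) such that for all `m, K`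
with `K ≤ log₂² m` and every design of format `(m, K)` of lower bandwidth `w`, `n ≤ 2^(C·log₂² m)` (`w = 1`:
Hessenberg / DAG-path designs). [folklore] -/
theorem thinStub_bandedSector (w : ℕ) : ∃ C : ℕ, ∀ (m K : ℕ), K ≤ Nat.log 2 m ^ 2 →
    ∀ (d : Fin K → ℕ) (v ε : Fin m → Fin m → Fin K → ℤ), (∀ a b l, ε a b l ≠ 0 → (a : ℕ) ≤ (b : ℕ) + w) →
    ∀ (n : ℕ) (θ : Fin (n + 1) → ℤ) (p : Fin (n + 1) → Equiv.Perm (Fin m) × (Fin m → Fin K)),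
      (∀ i j l, (ε i j l).natAbs ≤ 1) → StrictMono θ → (∀ k, IsDominant d v ε (θ k) (p k)) →
      (∀ k : Fin n, termSign ε (p k.castSucc) * termSign ε (p k.succ) < 0) →
      n ≤ 2 ^ (C * Nat.log 2 m ^ 2) := by
  obtain ⟨C', hC'⟩ := band_kPlusLogSq_fixedWidth w
  refine ⟨2 * C', fun m K hthin d v ε hε n θ p hε1 hθ hdom halt => ?_⟩
  exact (hC' m K d v ε hε n θ p hε1 hθ hdom halt).trans (two_pow_le_thin hthin)

/-- **The thin stub on the Hall-surplus sector, per width** (`C = 2(6w+7)`). [folklore] -/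
theorem thinStub_surplusSector (w : ℕ) : ∃ C : ℕ, ∀ (m K : ℕ), K ≤ Nat.log 2 m ^ 2 →
    ∀ (d : Fin K → ℕ) (v ε : Fin m → Fin m → Fin K → ℤ),
    (∀ c : ℕ, ((univ : Finset (Fin m)).filter
        (fun a : Fin m => ∃ b : Fin m, (b : ℕ) < c ∧ ∃ l : Fin K, ε a b l ≠ 0)).card ≤ c + w) →
    ∀ (n : ℕ) (θ : Fin (n + 1) → ℤ) (p : Fin (n + 1) → Equiv.Perm (Fin m) × (Fin m → Fin K)),
      (∀ i j l, (ε i j l).natAbs ≤ 1) → StrictMono θ → (∀ k, IsDominant d v ε (θ k) (p k)) →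
      (∀ k : Fin n, termSign ε (p k.castSucc) * termSign ε (p k.succ) < 0) →
      n ≤ 2 ^ (C * Nat.log 2 m ^ 2) := by
  obtain ⟨C', hC'⟩ := surplus_kPlusLogSq_fixedWidth w
  refine ⟨2 * C', fun m K hthin d v ε hε n θ p hε1 hθ hdom halt => ?_⟩
  exact (hC' m K d v ε hε n θ p hε1 hθ hdom halt).trans (two_pow_le_thin hthin)

end Summit.ValiantsHypothesis.ValiantsHypothesis.Theorems.KPlusLogSqLaw
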